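import Summits.CriticalPhenomena.CardyFormulaZ2.Theorems.CardyIKTransportIKLinearTransportWallDominationDefs

/-!
# `CardyIKTransport.IKLinearTransport` (stmt-CriticalPhenomena-5076, line `pinned-diagram-exchange`, lead c8 wave 1) —
# WALL DOMINATION: the product structure of the slab weight over the two half-slabs of a cell column

Support file (`--supports stmt-CriticalPhenomena-5076`): proves the registered sub-goal
`stub_productStructure : ProductStructure` of `…WallDominationDefs` §3, i.e. for the cylinder slab of `w₁ + w₂`
face columns cut at the cell column `w₁`:
* (i) summing over the slab is summing over the pairs (left part, right part) agreeing on the middle column — the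
  map `x ↦ (resLE x, resGE x)` is a bijection onto those pairs with inverse `joinCfg` (`join_res`, `resLE_join`,
  `resGE_join`, `Finset.sum_nbij'`);
* (ii) the slab weight of a join is the product of the weights of its two parts — the face product over
  `Fin (w₁ + w₂) × ZMod L` splits by `Fin.prod_univ_add`; a left face reads its corners and flag from the left
  part, a right face from the right part (its corners on the middle column are read from the left part, which
  agrees there with the right part);
* (iii) restricting a join gives the parts back (definitional unfolding);
* (iv) the total weight of the configurations of a standard slab with a prescribed wall colouring is the product of
  the column constants — induction on the width with the landed one-step marginal identity
  `CylBunchStub.sum_resLast` (doubly stochastic face kernels); at width `0` exactly one configuration has the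
  prescribed wall and its weight is the empty product.
No new definitions.
-/

noncomputable section

namespace Summit.CriticalPhenomena.CardyFormulaZ2.Theorems.IKLinearTransport.PinnedDiagramExchange.WallDomination

open scoped BigOperators Classical
open Finset
open Summit.CriticalPhenomena.CardyFormulaZ2.Cruxes.IKMixedBoxCrossing.DefectClosureExploration
open CylBunchStub (resLE resLast splitEquiv colConst)

namespace ProductStub

variable {w₁ w₂ L : ℕ}

/-! ## Values of a join at explicit cells and faces -/

/-- Cells of a join in the cell columns `0 … w₁` are those of the left part. -/
theorem join_fst_left (a : CylCfg w₁ L) (b : CylCfg w₂ L) {c : Fin (w₁ + w₂ + 1)} {c' : Fin (w₁ + 1)}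
    (hc : c.val = c'.val) (s : ZMod L) : (joinCfg a b).1 (c, s) = a.1 (c', s) := by
  unfold joinCfg
  dsimp only
  split_ifs with h
  · exact congrArg a.1 (Prod.ext (Fin.ext hc) rfl)
  · exact absurd (show c.val ≤ w₁ by have := c'.isLt; omega) h

/-- Cells of a join in the cell columns `w₁ … w₁ + w₂` are those of the right part, provided the two parts
agree on the middle column (which the join reads from the left part). -/
theorem join_fst_right (a : CylCfg w₁ L) (b : CylCfg w₂ L) (hab : (fun r => a.1 (Fin.last w₁, r)) = wallCol b)
    {c : Fin (w₁ + w₂ + 1)} {c' : Fin (w₂ + 1)} (hc : c.val = w₁ + c'.val) (s : ZMod L) :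
    (joinCfg a b).1 (c, s) = b.1 (c', s) := by
  unfold joinCfg
  dsimp only
  split_ifs with h
  · have hc' : c' = 0 := Fin.ext (by rw [Fin.val_zero]; omega)
    have key : ∀ hlt : c.val < w₁ + 1, a.1 (⟨c.val, hlt⟩, s) = b.1 (c', s) := fun hlt => by
      rw [show (⟨c.val, hlt⟩ : Fin (w₁ + 1)) = Fin.last w₁ from Fin.ext (show c.val = w₁ by omega), hc']
      exact congrFun hab s
    exact key _
  · exact congrArg b.1 (Prod.ext (Fin.ext (show c.val - w₁ = c'.val by omega)) rfl)

/-- Flags of a join in the face columns `0 … w₁ - 1` are those of the left part. -/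
theorem join_snd_left (a : CylCfg w₁ L) (b : CylCfg w₂ L) {f : Fin (w₁ + w₂)} {f' : Fin w₁}
    (hf : f.val = f'.val) (s : ZMod L) : (joinCfg a b).2 (f, s) = a.2 (f', s) := by
  unfold joinCfg
  dsimp only
  split_ifs with h
  · exact congrArg a.2 (Prod.ext (Fin.ext hf) rfl)
  · exact absurd (show f.val < w₁ by have := f'.isLt; omega) h

/-- Flags of a join in the face columns `w₁ … w₁ + w₂ - 1` are those of the right part. -/
theorem join_snd_right (a : CylCfg w₁ L) (b : CylCfg w₂ L) {f : Fin (w₁ + w₂)} {f' : Fin w₂}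
    (hf : f.val = w₁ + f'.val) (s : ZMod L) : (joinCfg a b).2 (f, s) = b.2 (f', s) := by
  unfold joinCfg
  dsimp only
  split_ifs with h
  · exact absurd h (by omega)
  · exact congrArg b.2 (Prod.ext (Fin.ext (show f.val - w₁ = f'.val by omega)) rfl)

/-! ## (iii) Restrictions of a join; a configuration is the join of its restrictions -/

/-- (iii, left) Restricting a join to the left part gives the left part back. -/
theorem resLE_join (a : CylCfg w₁ L) (b : CylCfg w₂ L) :
    resLE (Nat.le_add_right w₁ w₂) (joinCfg a b) = a := by
  refine Prod.ext (funext fun ⟨c, s⟩ => ?_) (funext fun ⟨f, s⟩ => ?_)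
  · show (joinCfg a b).1 (Fin.castLE _ c, s) = a.1 (c, s)
    exact join_fst_left a b (Fin.val_castLE _ c) s
  · show (joinCfg a b).2 (Fin.castLE _ f, s) = a.2 (f, s)
    exact join_snd_left a b (Fin.val_castLE _ f) s

/-- (iii, right) Restricting a join to the right part gives the right part back, provided the two parts agree on
the middle column. -/
theorem resGE_join (a : CylCfg w₁ L) (b : CylCfg w₂ L) (hab : (fun r => a.1 (Fin.last w₁, r)) = wallCol b) :
    resGE w₁ w₂ (joinCfg a b) = b := by
  refine Prod.ext (funext fun ⟨c, s⟩ => ?_) (funext fun ⟨f, s⟩ => ?_)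
  · show (joinCfg a b).1 (⟨w₁ + c.val, _⟩, s) = b.1 (c, s)
    exact join_fst_right a b hab (by rfl) s
  · show (joinCfg a b).2 (⟨w₁ + f.val, _⟩, s) = b.2 (f, s)
    exact join_snd_right a b (by rfl) s

/-- Every configuration of the slab is the join of its left and right parts. -/
theorem join_res (x : CylCfg (w₁ + w₂) L) :
    joinCfg (resLE (Nat.le_add_right w₁ w₂) x) (resGE w₁ w₂ x) = x := by
  refine Prod.ext (funext fun ⟨c, s⟩ => ?_) (funext fun ⟨f, s⟩ => ?_)
  · unfold joinCfg resGE CylBunchStub.resLE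
    dsimp only
    split_ifs with h
    · exact congrArg x.1 (Prod.ext (Fin.ext rfl) rfl)
    · exact congrArg x.1 (Prod.ext (Fin.ext (show w₁ + (c.val - w₁) = c.val by omega)) rfl)
  · unfold joinCfg resGE CylBunchStub.resLE
    dsimp only
    split_ifs with h
    · exact congrArg x.2 (Prod.ext (Fin.ext rfl) rfl)
    · exact congrArg x.2 (Prod.ext (Fin.ext (show w₁ + (f.val - w₁) = f.val by omega)) rfl)

/-- The left and right parts of a configuration agree on the middle column. -/
theorem agree_res (x : CylCfg (w₁ + w₂) L) :
    (fun r => (resLE (Nat.le_add_right w₁ w₂) x).1 (Fin.last w₁, r)) = wallCol (resGE w₁ w₂ x) :=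
  funext fun r => by
    show x.1 (Fin.castLE _ (Fin.last w₁), r) = x.1 (⟨w₁ + (0 : Fin (w₂ + 1)).val, _⟩, r)
    exact congrArg (fun i : Fin (w₁ + w₂ + 1) => x.1 (i, r)) (Fin.ext (by simp))

/-! ## (i) Summing over the slab through the pairs of agreeing parts -/

/-- (i) Summing over the slab is summing over the pairs (left part, right part) that agree on the middle column,
through `joinCfg`. -/
theorem sum_eq (w₁ w₂ L : ℕ) [NeZero L] (F : CylCfg (w₁ + w₂) L → ℝ) :
    ∑ x, F x = ∑ a : CylCfg w₁ L, ∑ b : CylCfg w₂ L,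
      if (fun r => a.1 (Fin.last w₁, r)) = wallCol b then F (joinCfg a b) else 0 := by
  have key : ∑ x, F x = ∑ p ∈ (univ : Finset (CylCfg w₁ L × CylCfg w₂ L)) with
      (fun r => p.1.1 (Fin.last w₁, r)) = wallCol p.2, F (joinCfg p.1 p.2) := by
    refine Finset.sum_nbij' (fun x => (resLE (Nat.le_add_right w₁ w₂) x, resGE w₁ w₂ x))
      (fun p => joinCfg p.1 p.2) (fun x _ => ?_) (fun _ _ => mem_univ _) (fun x _ => join_res x)
      (fun p hp => ?_) (fun x _ => congrArg F (join_res x).symm)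
    · exact mem_filter.2 ⟨mem_univ _, agree_res x⟩
    · exact Prod.ext (resLE_join p.1 p.2) (resGE_join p.1 p.2 (mem_filter.1 hp).2)
  rw [key, Finset.sum_filter, Fintype.sum_prod_type]

/-! ## (ii) The slab weight of a join -/

/-- (ii) The slab weight of a join of two agreeing parts is the product of the weights of the parts (left
faces read everything from the left part; right faces from the right part, their corners on the middle column
being read from the left part, which agrees there with the right part). -/
theorem weight_join (w₁ w₂ L : ℕ) [NeZero L] (τ : Fin (w₁ + w₂) → Bool) (a : CylCfg w₁ L)
    (b : CylCfg w₂ L) (hab : (fun r => a.1 (Fin.last w₁, r)) = wallCol b) :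
    cylWeight (w₁ + w₂) L τ (joinCfg a b) = cylWeight w₁ L (τL τ) a * cylWeight w₂ L (τR τ) b := by
  unfold cylWeight
  rw [Fintype.prod_prod_type, Fin.prod_univ_add, Fintype.prod_prod_type, Fintype.prod_prod_type]
  congr 1
  · refine Finset.prod_congr rfl fun j _ => Finset.prod_congr rfl fun r _ => ?_
    dsimp only [cylFaceOdd, τL]
    rw [join_fst_left a b (c := (Fin.castAdd w₂ j).castSucc) (c' := j.castSucc) (by simp) r,
      join_fst_left a b (c := (Fin.castAdd w₂ j).succ) (c' := j.succ) (by simp) r,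
      join_fst_left a b (c := (Fin.castAdd w₂ j).castSucc) (c' := j.castSucc) (by simp) (r + 1),
      join_fst_left a b (c := (Fin.castAdd w₂ j).succ) (c' := j.succ) (by simp) (r + 1),
      join_snd_left a b (f := Fin.castAdd w₂ j) (f' := j) (by simp) r]
  · refine Finset.prod_congr rfl fun j _ => Finset.prod_congr rfl fun r _ => ?_
    dsimp only [cylFaceOdd, τR]
    rw [join_fst_right a b hab (c := (Fin.natAdd w₁ j).castSucc) (c' := j.castSucc) (by simp) r,
      join_fst_right a b hab (c := (Fin.natAdd w₁ j).succ) (c' := j.succ) (by simp [Nat.add_assoc]) r,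
      join_fst_right a b hab (c := (Fin.natAdd w₁ j).castSucc) (c' := j.castSucc) (by simp) (r + 1),
      join_fst_right a b hab (c := (Fin.natAdd w₁ j).succ) (c' := j.succ) (by simp [Nat.add_assoc]) (r + 1),
      join_snd_right a b (f := Fin.natAdd w₁ j) (f' := j) (by simp) r]

/-! ## (iv) The total weight with a prescribed wall colouring -/

/-- The wall colouring of a configuration is that of its restriction without the last column. -/
theorem wallCol_resLast {w : ℕ} (x : CylCfg (w + 1) L) : wallCol (resLast x) = wallCol x := rfl

/-- (iv) The total weight of the configurations of a standard slab with a prescribed wall colouring is the product of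
the column constants (induction on the width with `CylBunchStub.sum_resLast`; at width `0` exactly one configuration
has the prescribed wall and its weight is `1`). -/
theorem wallSum (L : ℕ) [NeZero L] (ξ : ZMod L → Bool) : ∀ (w : ℕ) (τ : Fin w → Bool),
    (∑ x : CylCfg w L, if wallCol x = ξ then cylWeight w L τ x else 0) = ∏ j, colConst (τ j) L := by
  intro w
  induction w with
  | zero =>
    intro τ
    have huniq : ∀ x : CylCfg 0 L, wallCol x = ξ → x = ((fun c => ξ c.2, fun f => f.1.elim0) : CylCfg 0 L) :=
      fun x h => Prod.ext
        (funext fun ⟨c, r⟩ => by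
          have hc : c = 0 := Fin.ext (by rw [Fin.val_zero]; have := c.isLt; omega)
          subst hc
          exact congrFun h r)
        (funext fun ⟨f, _⟩ => f.elim0)
    have h0 : wallCol ((fun c => ξ c.2, fun f => f.1.elim0) : CylCfg 0 L) = ξ := rfl
    rw [Fin.prod_univ_zero, Finset.sum_eq_single ((fun c => ξ c.2, fun f => f.1.elim0) : CylCfg 0 L)
      (fun x _ hx => if_neg fun h => hx (huniq x h)) (fun h => absurd (mem_univ _) h), if_pos h0]
    unfold cylWeight
    exact Fintype.prod_empty _
  | succ w ih =>
    intro τ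
    have key : ∑ x : CylCfg (w + 1) L,
        (if wallCol (resLast x) = ξ then (1 : ℝ) else 0) * cylWeight (w + 1) L τ x =
          (∑ y : CylCfg w L, (if wallCol y = ξ then (1 : ℝ) else 0) * cylWeight w L (fun j => τ j.castSucc) y) *
            colConst (τ (Fin.last w)) L :=
      CylBunchStub.sum_resLast τ (fun y => if wallCol y = ξ then (1 : ℝ) else 0)
    calc (∑ x : CylCfg (w + 1) L, if wallCol x = ξ then cylWeight (w + 1) L τ x else 0)
        = ∑ x : CylCfg (w + 1) L, (if wallCol (resLast x) = ξ then (1 : ℝ) else 0) * cylWeight (w + 1) L τ x :=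
          Finset.sum_congr rfl fun x _ => by rw [boole_mul]; rfl
      _ = (∑ y : CylCfg w L, (if wallCol y = ξ then (1 : ℝ) else 0) * cylWeight w L (fun j => τ j.castSucc) y) *
            colConst (τ (Fin.last w)) L := key
      _ = (∑ y : CylCfg w L, if wallCol y = ξ then cylWeight w L (fun j => τ j.castSucc) y else 0) *
            colConst (τ (Fin.last w)) L :=
          congrArg (· * colConst (τ (Fin.last w)) L) (Finset.sum_congr rfl fun y _ => boole_mul _ _)
      _ = (∏ j : Fin w, colConst (τ j.castSucc) L) * colConst (τ (Fin.last w)) L := by rw [ih]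
      _ = ∏ j : Fin (w + 1), colConst (τ j) L := (Fin.prod_univ_castSucc fun j => colConst (τ j) L).symm

end ProductStub

open ProductStub in
/-- **STUB · `stub_productStructure`** (registered sub-goal `ProductStructure` of `…WallDominationDefs` §3):
(i) the slab sum is the sum over agreeing pairs of parts through `joinCfg`; (ii) the slab weight of a join
factorises over the two half-slabs of the middle cell column; (iii) restricting a join gives the parts back;
(iv) the wall-conditioned total weight of a standard slab is the product of the column constants. -/
theorem stub_productStructure : ProductStructure := by
  unfold ProductStructure
  exact ⟨fun w₁ w₂ L _ F => sum_eq w₁ w₂ L F,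
    fun w₁ w₂ L _ τ a b hab => weight_join w₁ w₂ L τ a b hab,
    fun _ _ _ a b hab => ⟨resLE_join a b, resGE_join a b hab⟩,
    fun w L _ τ ξ => wallSum L ξ w τ⟩

end Summit.CriticalPhenomena.CardyFormulaZ2.Theorems.IKLinearTransport.PinnedDiagramExchange.WallDomination

end
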